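import Literature.AlgebraicTopology.FundamentalGroup.TopologicalGroupCovering
import HarnessLib

/-!
# Intermediate coverings of the `n`-th power covering of a compact commutative group

Let `G` be a compact Hausdorff path-connected commutative topological group whose `n`-th power map
`x ↦ xⁿ` is surjective with finite kernel `G[n]` (so that it is a normal covering with deck group
`G[n]`, `TopologicalGroupCovering.lean`), and let `x ↦ xⁿ` be factored through a second compact
Hausdorff path-connected group `G'` by continuous homomorphisms `h : G → G'` (surjective) and
`r : G' → G`, `r ∘ h = (x ↦ xⁿ)`. Then `r` is again a covering map (`isQuotientCoveringMap_right`)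
and this file computes the image of `π₁(G')` in `π₁(G)`:

* `monodromy_right_eq`: the monodromy of the covering `r` along a loop `γ` at `1` is `h(g_γ)`,
  where `g_γ ∈ G[n]` is the monodromy of `x ↦ xⁿ` along `γ` (the `r`-lift of `γ` is `h ∘ γ̃` for
  the `xⁿ`-lift `γ̃`; uniqueness of lifts, Hatcher, *Algebraic Topology*, Prop. 1.34);
* `range_mapOfEq_right_eq_comap`: **`r_* π₁(G', 1) = χ⁻¹(G[n] ∩ ker h)`**, where
  `χ : π₁(G, 1) → G[n]ᵒᵖ` is the monodromy surjection of the covering `x ↦ xⁿ` (Hatcher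
  Prop. 1.39–1.40: intermediate coverings `G̃/F → G` of a normal covering `G̃ → G` with deck group
  `G[n]` correspond to subgroups `F ⊆ G[n]`, with `π₁`-image the preimage of `F`);
* `range_mapOfEq_right_eq_of_ker_eq`: consequently, if `K ⊆ π₁(G, 1)` contains all `n`-th powers
  and `ker h = χ(K)` (un-opposed, as a subgroup of `G[n] ⊆ G`), then **`r_* π₁(G', 1) = K`**.

For a complex abelian variety `A` and a finite subgroup `S ⊆ A[n](ℂ)`, the quotient isogeny
`h : A → A/S` and the factorization `r : A/S → A` of `[n]` through it are such a pair; this is how a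
finite-index subgroup `K` of `π₁(A(ℂ))` is realized by an isogeny `r` of abelian varieties
(used towards `Literature.AlgebraicGeometry.Motives.isIso_bettiCohomology_map_abelJacobi`).
Everything is proved; no definitions.

## References

* A. Hatcher, *Algebraic Topology*, CUP 2002, §1.3 Prop. 1.34 (unique lifting), Prop. 1.36,
  Prop. 1.39–1.40 (deck groups and intermediate coverings). [HatcherAT2002]
-/

noncomputable section

open Function Topology

universe u v

namespace Literature.AlgebraicTopology.FundamentalGroup

/-! ### Elementary facts about a factorization `r ∘ h = (x ↦ xⁿ)` -/

section Basic

variable {G : Type u} {G' : Type v} [CommGroup G] [Group G'] (h : G →* G') (r : G' →* G) (n : ℕ)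

/-- `r` is surjective (`r ∘ h = (x ↦ xⁿ)` is). [folklore] -/
theorem surjective_right (hcomp : ∀ x, r (h x) = x ^ n) (hpow : Surjective fun x : G => x ^ n) :
    Surjective r := fun x => by
  obtain ⟨y, rfl⟩ := hpow x
  exact ⟨h y, hcomp y⟩

/-- `ker r ⊆ h(G[n])` is finite when `h` is onto and `G[n]` is finite. [folklore] -/
theorem finite_ker_right (hcomp : ∀ x, r (h x) = x ^ n) (hsurj : Surjective h)
    (hfin : ((powMonoidHom n : G →* G).ker : Set G).Finite) : (r.ker : Set G').Finite := by
  refine (hfin.image h).subset fun y hy => ?_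
  obtain ⟨x, rfl⟩ := hsurj y
  refine ⟨x, ?_, rfl⟩
  rw [SetLike.mem_coe, MonoidHom.mem_ker] at hy ⊢
  rw [powMonoidHom_apply, ← hcomp x, hy]

/-- The base point `1 ∈ G` lies in the fibre of `x ↦ xⁿ` over `1`. [folklore] -/
theorem one_mem_preimage_pow : (1 : G) ∈ (powMonoidHom n : G →* G) ⁻¹' {1} := by simp

/-- The base point `1 ∈ G'` lies in the fibre of `r` over `1`. [folklore] -/
theorem one_mem_preimage_right : (1 : G') ∈ (r : G' → G) ⁻¹' {1} := by simp

/-- Transport of a lifted path class: for a path class `L` in `G` from `a` to `b` and a continuous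
`p` with `r ∘ h = p`, the image under `r` of (the cast of) `h ∘ L` is (the cast of) `p ∘ L`.
[folklore] -/
theorem map_cast_map_eq [TopologicalSpace G] [TopologicalSpace G'] (hh : Continuous h)
    (hr : Continuous r) (p : C(G, G)) (hcomp : ∀ x, r (h x) = p x) {a b : G}
    (L : Path.Homotopic.Quotient a b) {a' b' : G'} (ha : a' = h a) (hb : b' = h b) :
    ((L.map ⟨h, hh⟩).cast ha hb).map ⟨r, hr⟩ =
      (L.map p).cast (show r a' = p a by rw [ha, hcomp]) (show r b' = p b by rw [hb, hcomp]) := by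
  subst ha hb
  induction L using Quotient.inductionOn with | h ℓ =>
  change Path.Homotopic.Quotient.mk (((ℓ.map hh).cast rfl rfl).map hr) =
    Path.Homotopic.Quotient.mk ((ℓ.map p.continuous).cast _ _)
  congr 1
  ext x
  exact hcomp (ℓ x)

end Basic

/-! ### The covering `r` and the image of `π₁(G')` -/

section Covering

variable {G : Type u} {G' : Type v} [TopologicalSpace G] [CommGroup G] [IsTopologicalGroup G]
  [CompactSpace G] [T2Space G]
  [TopologicalSpace G'] [Group G'] [IsTopologicalGroup G'] [CompactSpace G'] [T2Space G']
  (h : G →* G') (r : G' →* G) (n : ℕ)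

omit [IsTopologicalGroup G] [CompactSpace G] in
/-- **`r` is a (quotient) covering map** (continuous surjective homomorphism with finite kernel of
compact Hausdorff groups). [folklore] -/
theorem isQuotientCoveringMap_right (hr : Continuous r) (hcomp : ∀ x, r (h x) = x ^ n)
    (hsurj : Surjective h) (hpow : Surjective fun x : G => x ^ n)
    (hfin : ((powMonoidHom n : G →* G).ker : Set G).Finite) : IsQuotientCoveringMap r r.ker :=
  isQuotientCoveringMap_monoidHom r hr (surjective_right h r n hcomp hpow)
    (finite_ker_right h r n hcomp hsurj hfin)

omit [CompactSpace G'] [T2Space G'] in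
/-- The `n`-th power map is a quotient covering map with group `G[n]`. [folklore] -/
theorem isQuotientCoveringMap_pow (hpow : Surjective fun x : G => x ^ n)
    (hfin : ((powMonoidHom n : G →* G).ker : Set G).Finite) :
    IsQuotientCoveringMap (powMonoidHom n : G →* G) (powMonoidHom n : G →* G).ker :=
  isQuotientCoveringMap_monoidHom (powMonoidHom n : G →* G) (continuous_pow n) hpow hfin

/-- **The monodromy of `r` is `h` applied to the monodromy of `x ↦ xⁿ`**: for a loop class `γ` at
`1 ∈ G`, if the `xⁿ`-lift of `γ` from `1` ends at `g ∈ G[n]`, then the `r`-lift of `γ` from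
`1 ∈ G'` ends at `h g` — it is the image under `h` of the `xⁿ`-lift (`r ∘ h = xⁿ` and uniqueness of
lifts, Hatcher Prop. 1.34). [cite: HatcherAT2002, §1.3 Prop. 1.34] -/
theorem monodromy_right_eq (hh : Continuous h) (hr : Continuous r) (hcomp : ∀ x, r (h x) = x ^ n)
    (hsurj : Surjective h) (hpow : Surjective fun x : G => x ^ n)
    (hfin : ((powMonoidHom n : G →* G).ker : Set G).Finite) (γ : FundamentalGroup G (1 : G)) :
    ((isQuotientCoveringMap_right h r n hr hcomp hsurj hpow hfin).isCoveringMap.monodromy γ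
        ⟨1, one_mem_preimage_right r⟩ : G') =
      h ((isQuotientCoveringMap_pow n hpow hfin (G := G)).isCoveringMap.monodromy γ
        ⟨1, one_mem_preimage_pow n⟩ : G) := by
  have covn : IsCoveringMap (powMonoidHom n : G →* G) :=
    (isQuotientCoveringMap_pow n hpow hfin (G := G)).isCoveringMap
  have covr : IsCoveringMap r := (isQuotientCoveringMap_right h r n hr hcomp hsurj hpow hfin).isCoveringMap
  let e : (powMonoidHom n : G →* G) ⁻¹' {1} := ⟨1, one_mem_preimage_pow n⟩
  let g : (powMonoidHom n : G →* G) ⁻¹' {1} := covn.monodromy γ e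
  -- the end point `h g` lies over `1`: `r (h g) = gⁿ = 1`
  have hg1 : (g : G) ^ n = 1 := by
    have := g.2
    rwa [Set.mem_preimage, powMonoidHom_apply, Set.mem_singleton_iff] at this
  have hrg : h (g : G) ∈ (r : G' → G) ⁻¹' {1} := by
    rw [Set.mem_preimage, Set.mem_singleton_iff, hcomp, hg1]
  -- the `r`-lift of `γ` from `1` is `h ∘ (xⁿ-lift)`
  let Γ : Path.Homotopic.Quotient (1 : G') (h (g : G)) :=
    ((covn.liftPathQuotient γ e).map ⟨h, hh⟩).cast (map_one h).symm rfl
  have key := covr.monodromy_eq_of_map_eq (γ := γ) (ex := ⟨1, one_mem_preimage_right r⟩)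
    (ey := ⟨h (g : G), hrg⟩) Γ (by
      change (((covn.liftPathQuotient γ e).map ⟨h, hh⟩).cast (map_one h).symm rfl).map ⟨r, hr⟩ = _
      rw [map_cast_map_eq h r hh hr ⟨(powMonoidHom n : G →* G), covn.continuous⟩ hcomp,
        covn.map_liftPathQuotient, Path.Homotopic.Quotient.cast_cast])
  exact congrArg Subtype.val key

/-- **`r_* π₁(G', 1) = χ⁻¹(G[n] ∩ ker h)`**: a loop class `γ` at `1 ∈ G` lifts to a loop of `G'`
iff the monodromy `h(g_γ)` of `r` along `γ` is `1`, iff `g_γ = χ(γ) · 1 ∈ ker h`, where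
`χ : π₁(G, 1) → G[n]ᵒᵖ` is the monodromy homomorphism of the normal covering `x ↦ xⁿ`
(Hatcher Prop. 1.39–1.40). [cite: HatcherAT2002, §1.3 Prop. 1.39] -/
theorem range_mapOfEq_right_eq_comap [PathConnectedSpace G] (hh : Continuous h) (hr : Continuous r)
    (hcomp : ∀ x, r (h x) = x ^ n) (hsurj : Surjective h) (hpow : Surjective fun x : G => x ^ n)
    (hfin : ((powMonoidHom n : G →* G).ker : Set G).Finite) :
    (FundamentalGroup.mapOfEq (⟨r, hr⟩ : C(G', G)) (map_one r)).range =
      (Subgroup.op (h.ker.subgroupOf (powMonoidHom n : G →* G).ker)).comap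
        ((isQuotientCoveringMap_pow n hpow hfin (G := G)).fundamentalGroupToMulOpposite
          ⟨1, one_mem_preimage_pow n⟩) := by
  have hpn : IsQuotientCoveringMap (powMonoidHom n : G →* G) (powMonoidHom n : G →* G).ker :=
    isQuotientCoveringMap_pow n hpow hfin
  have hpr : IsQuotientCoveringMap r r.ker := isQuotientCoveringMap_right h r n hr hcomp hsurj hpow hfin
  let e : (powMonoidHom n : G →* G) ⁻¹' {1} := ⟨1, one_mem_preimage_pow n⟩
  let e' : (r : G' → G) ⁻¹' {1} := ⟨1, one_mem_preimage_right r⟩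
  ext γ
  -- `γ ∈ r_* π₁ ↔ monodromy_r γ e' = e'`
  have h1 : γ ∈ (FundamentalGroup.mapOfEq (⟨r, hr⟩ : C(G', G)) (map_one r)).range ↔
      hpr.isCoveringMap.monodromy γ e' = e' := by
    rw [← hpr.ker_monodromyPerm e', MonoidHom.mem_ker, ← hpr.monodromy_eq_id_iff e']
    constructor
    · intro hγ
      funext x
      have := congrArg (fun f : Equiv.Perm ((r : G' → G) ⁻¹' {1}) => f x) hγ
      simpa using this
    · intro hγ
      exact Equiv.ext (congrFun hγ)
  rw [h1, Subgroup.mem_comap, Subgroup.mem_op, Subgroup.mem_subgroupOf, MonoidHom.mem_ker,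
    Subtype.ext_iff, monodromy_right_eq h r n hh hr hcomp hsurj hpow hfin γ]
  -- `(χ γ).unop • 1 = g_γ`
  have h2 := hpn.unop_fundamentalGroupToMulOpposite_smul (e := e) (γ := γ)
  rw [Submonoid.smul_def, smul_eq_mul, mul_one] at h2
  change h _ = 1 ↔ h _ = 1
  rw [← h2]

/-- **Realizing a subgroup of `π₁` by the covering `r`**: if `K ⊆ π₁(G, 1)` contains all `n`-th
powers and the kernel of `h` is exactly `χ(K) ⊆ G[n]` (as a subgroup of `G`), then
`r_* π₁(G', 1) = K` (Hatcher Prop. 1.36 / 1.39: `χ⁻¹(χ(K)) = K · ker χ = K`, as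
`ker χ = (x ↦ xⁿ)_* π₁ = {pⁿ}`). [cite: HatcherAT2002, §1.3 Prop. 1.36 and Prop. 1.39] -/
theorem range_mapOfEq_right_eq_of_ker_eq [PathConnectedSpace G] (hh : Continuous h)
    (hr : Continuous r) (hcomp : ∀ x, r (h x) = x ^ n) (hsurj : Surjective h)
    (hpow : Surjective fun x : G => x ^ n) (hfin : ((powMonoidHom n : G →* G).ker : Set G).Finite)
    (K : Subgroup (FundamentalGroup G (1 : G))) (hK : ∀ p : FundamentalGroup G (1 : G), p ^ n ∈ K)
    (hker : h.ker = ((K.map ((isQuotientCoveringMap_pow n hpow hfin (G := G)).fundamentalGroupToMulOpposite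
      ⟨1, one_mem_preimage_pow n⟩)).unop).map (powMonoidHom n : G →* G).ker.subtype) :
    (FundamentalGroup.mapOfEq (⟨r, hr⟩ : C(G', G)) (map_one r)).range = K := by
  have hpn : IsQuotientCoveringMap (powMonoidHom n : G →* G) (powMonoidHom n : G →* G).ker :=
    isQuotientCoveringMap_pow n hpow hfin
  rw [range_mapOfEq_right_eq_comap h r n hh hr hcomp hsurj hpow hfin]
  have hsub : h.ker.subgroupOf (powMonoidHom n : G →* G).ker =
      (K.map (hpn.fundamentalGroupToMulOpposite ⟨1, one_mem_preimage_pow n⟩)).unop := by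
    rw [hker]
    ext x
    rw [Subgroup.mem_subgroupOf, Subgroup.mem_map]
    constructor
    · rintro ⟨y, hy, hyx⟩
      have : y = x := Subtype.ext hyx
      rwa [← this]
    · intro hx
      exact ⟨x, hx, rfl⟩
  rw [hsub, Subgroup.op_unop, Subgroup.comap_map_eq, sup_eq_left]
  -- `ker χ = (x ↦ xⁿ)_* π₁ = {pⁿ} ⊆ K`
  intro p hp
  rw [hpn.ker_fundamentalGroupToMulOpposite, hpn.ker_monodromyPerm ⟨1, one_mem_preimage_pow n⟩] at hp
  obtain ⟨q, rfl⟩ := hp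
  have : FundamentalGroup.mapOfEq (⟨(powMonoidHom n : G →* G), hpn.continuous⟩ : C(G, G))
      (one_mem_preimage_pow n) q = q ^ n := by
    rw [← mapOfEq_powMap n q]
    rfl
  rw [this]
  exact hK q

end Covering

end Literature.AlgebraicTopology.FundamentalGroup

end
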